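import Mathlib.NumberTheory.PrimeCounting
import Mathlib.NumberTheory.DirichletCharacter.Bounds
import Mathlib.NumberTheory.ArithmeticFunction.Liouville
import Mathlib.NumberTheory.ArithmeticFunction.Moebius
import Mathlib.Analysis.SpecialFunctions.Pow.Real
import Mathlib.Order.Filter.AtTopBot.Defs
import HarnessLib

-- provenance: harness21/H21/H21/Prelude/AntSieve/PretentiousDistance.lean @ bc880d9 (interim HEAD d8f2665); M5 mechanical rewrite
/-!
# Pretentious distance (trunk AntSieve, C16 / D-SIEVE-6)

The Granville–Soundararajan "pretentious" distance between two arithmetic functions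
`f g : ℕ → ℂ` up to height `x`,
`𝔻(f, g; x)² = ∑_{p ≤ x} (1 - Re (f p * conj (g p))) / p`,
together with the non-pretentiousness quantities
`M_χ(g; x) = inf_{|t| ≤ x} 𝔻(g, n ↦ χ(n) n^{it}; x)²` and
`M(g; x, Q) = inf_{q ≤ Q} inf_{χ mod q} M_χ(g; x)` (Tao 2016, (1.8)),
and the two hypotheses used by the Elliott-type conjectures/theorems:

* `Literature.IsNonpretentious g`: for every fixed Dirichlet character `χ`, `M_χ(g; x) → ∞`
  (the hypothesis of Matomäki–Radziwiłł–Tao, Conjecture 1.5);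
* `Literature.IsUniformlyNonpretentious g`: `M(g; x, x) → ∞` (stronger; uniform in `q ≤ x`).

## Sources
* A. Granville, K. Soundararajan, *Large character sums: pretentious characters and the
  Pólya–Vinogradov theorem*, J. Amer. Math. Soc. 20 (2007); and *Pretentious multiplicative
  functions and an inequality for the zeta-function*, CRM Proc. (2008), Lemma 3.1 (triangle
  inequality).
* K. Matomäki, M. Radziwiłł, T. Tao, *An averaged form of Chowla's conjecture*,
  Algebra & Number Theory 9 (2015), §1, Conjecture 1.5.
* T. Tao, *The logarithmically averaged Chowla and Elliott conjectures for two-point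
  correlations*, Forum Math. Pi 4 (2016), (1.8) and Theorem 1.3.

## Mathlib
Mathlib (searched: `pretentious`, `primesLE`, `DirichletCharacter`, `liouville`, `moebius`) has no
pretentious distance. We use `Nat.primesLE`, `starRingEnd ℂ` (`conj`), `DirichletCharacter ℂ q`,
complex powers `(n : ℂ) ^ (t * I)`, `ArithmeticFunction.liouville`, `ArithmeticFunction.moebius`.
Statements about `ArithmeticFunction ℂ` apply through the coercion to `ℕ → ℂ` (checked:
`IsNonpretentious (g : ArithmeticFunction ℂ)` elaborates); no local multiplicativity predicate is
introduced.

## Design / junk values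
* All functions take `f g : ℕ → ℂ` and a real height `x`; primes are summed over
  `Nat.primesLE ⌊x⌋₊`, so `x < 2` gives the empty sum `0`.
* `charNonpretentiousness g χ x` is an `iInf` over the subtype `Set.Icc (-x) x`; for `x < 0` this
  is empty and the value is the junk `sInf ∅ = 0`. For `x ≥ 0` the family is nonempty; it is
  bounded below by `0` when `g` is `1`-bounded (then each summand is nonnegative), and in general
  bounded below since the sum is finite and continuous in `t` on a compact interval.
* `nonpretentiousness g x Q` is an `iInf` over `q ∈ Set.Icc 1 ⌊Q⌋₊`; for `Q < 1` it is the junk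
  value `0`.
-/

open scoped ComplexConjugate
open Filter Complex

namespace Literature.NumberTheory.Sieve

noncomputable section

/-- The square of the Granville–Soundararajan pretentious distance between `f g : ℕ → ℂ` up to
height `x`: `𝔻(f, g; x)² = ∑_{p ≤ x} (1 - Re (f(p) · conj (g(p)))) / p`, the sum ranging over primes
`p ≤ ⌊x⌋₊`. (Granville–Soundararajan 2007, §1.) [cite: GranvilleSoundararajan2007, §1] -/
def pretentiousDistSq (f g : ℕ → ℂ) (x : ℝ) : ℝ :=
  ∑ p ∈ Nat.primesLE ⌊x⌋₊, (1 - (f p * conj (g p)).re) / (p : ℝ)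

/-- The Granville–Soundararajan pretentious distance `𝔻(f, g; x) = √(𝔻(f, g; x)²)`.
For `f, g` not `1`-bounded the square may be negative, in which case `Real.sqrt` returns the
junk value `0`. (Granville–Soundararajan 2007, §1.) [cite: GranvilleSoundararajan2007, §1] -/
def pretentiousDist (f g : ℕ → ℂ) (x : ℝ) : ℝ :=
  Real.sqrt (pretentiousDistSq f g x)

/-- The twisted character `n ↦ χ(n) n^{it}` attached to a Dirichlet character `χ` mod `q` and a
real `t`; here `n^{it} = (n : ℂ) ^ (t * I)` (Mathlib `cpow`, with `0 ^ (it) ` junk at `n = 0`,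
irrelevant since only prime arguments are used). (Matomäki–Radziwiłł–Tao 2015, (1.11).) [cite: Tao2015, (1.11] -/
def twistedChar {q : ℕ} (χ : DirichletCharacter ℂ q) (t : ℝ) : ℕ → ℂ :=
  fun n ↦ χ n * (n : ℂ) ^ ((t : ℂ) * I)

/-- The per-character non-pretentiousness `M_χ(g; x) = inf_{|t| ≤ x} 𝔻(g, χ(n) n^{it}; x)²` of
`g : ℕ → ℂ` with respect to a Dirichlet character `χ`. Junk value `0` for `x < 0` (empty index
type). (Matomäki–Radziwiłł–Tao 2015, (1.12); Tao 2016, (1.7).) [cite: Tao2015, (1.12] -/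
def charNonpretentiousness (g : ℕ → ℂ) {q : ℕ} (χ : DirichletCharacter ℂ q) (x : ℝ) : ℝ :=
  ⨅ t : Set.Icc (-x) x, pretentiousDistSq g (twistedChar χ (t : ℝ)) x

/-- Tao's non-pretentiousness `M(g; x, Q) = inf_{1 ≤ q ≤ Q} inf_{χ mod q} M_χ(g; x)`.
Junk value `0` for `Q < 1` (empty index type). (Tao 2016, (1.8).) [cite: Tao2016, (1.8] -/
def nonpretentiousness (g : ℕ → ℂ) (x Q : ℝ) : ℝ :=
  ⨅ q : Set.Icc 1 ⌊Q⌋₊, ⨅ χ : DirichletCharacter ℂ (q : ℕ), charNonpretentiousness g χ x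

/-- `g` is *non-pretentious*: for every modulus `q ≥ 1` and every Dirichlet character `χ` mod `q`,
`M_χ(g; x) → ∞` as `x → ∞`, i.e. `g` does not pretend to be any twisted character
`χ(n) n^{it}`. This is the hypothesis of Matomäki–Radziwiłł–Tao 2015, Conjecture 1.5
(per fixed character). [cite: Tao2015, Conjecture 1.5 (per fixed character] -/
def IsNonpretentious (g : ℕ → ℂ) : Prop :=
  ∀ (q : ℕ) [NeZero q] (χ : DirichletCharacter ℂ q),
    Tendsto (fun x : ℝ ↦ charNonpretentiousness g χ x) atTop atTop

/-- `g` is *uniformly non-pretentious*: `M(g; x, x) → ∞` as `x → ∞`, i.e. non-pretentiousness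
uniformly in all characters of modulus `q ≤ x`. Stronger than `IsNonpretentious`.
(Tao 2016, hypothesis shape of Theorem 1.3 / (1.8).) [cite: Tao2016, hypothesis shape of Theorem 1.3 / (1.8] -/
def IsUniformlyNonpretentious (g : ℕ → ℂ) : Prop :=
  Tendsto (fun x : ℝ ↦ nonpretentiousness g x x) atTop atTop

/-! ## Basic API -/

section API

variable {f g f₁ f₂ g₁ g₂ h : ℕ → ℂ} {x y : ℝ}

/-- For `1`-bounded `f, g` the squared pretentious distance is nonnegative, since each summand
`(1 - Re (f p conj (g p))) / p` is. (Granville–Soundararajan 2007, §1.) [cite: GranvilleSoundararajan2007, §1] -/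
theorem pretentiousDistSq_nonneg (hf : ∀ n, ‖f n‖ ≤ 1) (hg : ∀ n, ‖g n‖ ≤ 1) (x : ℝ) :
    0 ≤ pretentiousDistSq f g x := by
  refine Finset.sum_nonneg fun p _ ↦ div_nonneg (sub_nonneg.mpr ?_) (Nat.cast_nonneg p)
  calc (f p * conj (g p)).re ≤ ‖f p * conj (g p)‖ := Complex.re_le_norm _
    _ = ‖f p‖ * ‖g p‖ := by rw [norm_mul, Complex.norm_conj]
    _ ≤ 1 * 1 := mul_le_mul (hf p) (hg p) (norm_nonneg _) zero_le_one
    _ = 1 := one_mul 1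

/-- The squared pretentious distance is symmetric. [folklore] -/
theorem pretentiousDistSq_comm (f g : ℕ → ℂ) (x : ℝ) :
    pretentiousDistSq f g x = pretentiousDistSq g f x := by
  unfold pretentiousDistSq
  refine Finset.sum_congr rfl fun p _ ↦ ?_
  rw [← Complex.conj_re (f p * conj (g p)), map_mul, Complex.conj_conj, mul_comm]

/-- The pretentious distance is symmetric: `𝔻(f, g; x) = 𝔻(g, f; x)`.
(Granville–Soundararajan 2007, §1.) [cite: GranvilleSoundararajan2007, §1] -/
theorem pretentiousDist_comm (f g : ℕ → ℂ) (x : ℝ) :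
    pretentiousDist f g x = pretentiousDist g f x := by
  rw [pretentiousDist, pretentiousDist, pretentiousDistSq_comm]

/-- **Triangle inequality** for the pretentious distance between `1`-bounded functions:
`𝔻(f, h; x) ≤ 𝔻(f, g; x) + 𝔻(g, h; x)`.
(Granville–Soundararajan 2008, Lemma 3.1; Granville–Soundararajan 2007, §1.) [cite: GranvilleSoundararajan2008, Lemma 3.1] -/
def pretentiousDist_triangle : Prop :=
  ∀ (hf : ∀ n, ‖f n‖ ≤ 1) (hg : ∀ n, ‖g n‖ ≤ 1) (hh : ∀ n, ‖h n‖ ≤ 1) (x : ℝ),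
    pretentiousDist f h x ≤ pretentiousDist f g x + pretentiousDist g h x

/-- The multiplicative form of the Granville–Soundararajan triangle inequality for `1`-bounded
functions: `𝔻(f₁ f₂, g₁ g₂; x) ≤ 𝔻(f₁, g₁; x) + 𝔻(f₂, g₂; x)`.
(Granville–Soundararajan 2008, Lemma 3.1.) [cite: GranvilleSoundararajan2008, Lemma 3.1] -/
def pretentiousDist_mul_mul_le : Prop :=
  ∀ (hf₁ : ∀ n, ‖f₁ n‖ ≤ 1) (hf₂ : ∀ n, ‖f₂ n‖ ≤ 1) (hg₁ : ∀ n, ‖g₁ n‖ ≤ 1) (hg₂ : ∀ n, ‖g₂ n‖ ≤ 1) (x : ℝ),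
    pretentiousDist (f₁ * f₂) (g₁ * g₂) x ≤ pretentiousDist f₁ g₁ x + pretentiousDist f₂ g₂ x

/-- The squared pretentious distance of `1`-bounded functions is monotone in the height `x`
(more nonnegative summands). [folklore] -/
theorem pretentiousDistSq_mono (hf : ∀ n, ‖f n‖ ≤ 1) (hg : ∀ n, ‖g n‖ ≤ 1) :
    Monotone (pretentiousDistSq f g) := by
  intro x y hxy
  refine Finset.sum_le_sum_of_subset_of_nonneg (fun p hp ↦ ?_) fun p _ _ ↦ ?_
  · rw [Nat.mem_primesLE] at hp ⊢
    exact ⟨hp.1.trans (Nat.floor_le_floor hxy), hp.2⟩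
  · refine div_nonneg (sub_nonneg.mpr ?_) (Nat.cast_nonneg p)
    calc (f p * conj (g p)).re ≤ ‖f p * conj (g p)‖ := Complex.re_le_norm _
      _ = ‖f p‖ * ‖g p‖ := by rw [norm_mul, Complex.norm_conj]
      _ ≤ 1 * 1 := mul_le_mul (hf p) (hg p) (norm_nonneg _) zero_le_one
      _ = 1 := one_mul 1

/-- If `f` is unimodular on primes then `𝔻(f, f; x)² = 0`. [folklore] -/
theorem pretentiousDistSq_self_eq_zero (hf : ∀ p, p.Prime → ‖f p‖ = 1) (x : ℝ) :
    pretentiousDistSq f f x = 0 := by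
  refine Finset.sum_eq_zero fun p hp ↦ ?_
  have : (f p * conj (f p)).re = 1 := by
    rw [Complex.mul_conj, Complex.ofReal_re,
      Complex.normSq_eq_norm_sq, hf p (Nat.prime_of_mem_primesLE hp), one_pow]
  simp [this]

/-- For `x ≥ 0` and `1`-bounded `g`, the per-character non-pretentiousness `M_χ(g; x)` is
nonnegative (an infimum over a nonempty family of nonnegative reals). [folklore] -/
theorem charNonpretentiousness_nonneg (hg : ∀ n, ‖g n‖ ≤ 1) {q : ℕ}
    (χ : DirichletCharacter ℂ q) (hx : 0 ≤ x) : 0 ≤ charNonpretentiousness g χ x := by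
  have : Nonempty (Set.Icc (-x) x) := ⟨⟨0, by simp [hx]⟩⟩
  refine le_ciInf fun t ↦ pretentiousDistSq_nonneg hg (fun n ↦ ?_) x
  unfold twistedChar
  rw [norm_mul]
  refine mul_le_one₀ (χ.norm_le_one n) (norm_nonneg _) ?_
  rcases Nat.eq_zero_or_pos n with rfl | hn
  · by_cases ht : ((t : ℝ) : ℂ) * I = 0
    · simp [ht]
    · simp [Complex.zero_cpow ht]
  · rw [Complex.norm_natCast_cpow_of_pos hn]
    simp

/-- `M(g; x, Q) ≤ M_χ(g; x)` for every character `χ` of modulus `1 ≤ q ≤ Q`, provided `x ≥ 0`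
and `g` is `1`-bounded (so that all the infima involved are over families bounded below).
(Tao 2016, (1.8).) [cite: Tao2016, (1.8] -/
def nonpretentiousness_le_charNonpretentiousness : Prop :=
  ∀ (hg : ∀ n, ‖g n‖ ≤ 1) (hx : 0 ≤ x) {Q : ℝ} {q : ℕ} (hq : 1 ≤ q) (hqQ : (q : ℝ) ≤ Q) (χ : DirichletCharacter ℂ q),
    nonpretentiousness g x Q ≤ charNonpretentiousness g χ x

/-- Uniform non-pretentiousness implies non-pretentiousness with respect to every fixed
character, for `1`-bounded `g`. [cite: TaoFMP2016, §1 (1.8): M(g;x,Q) ≤ M_χ(g;x) for q ≤ Q] -/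
def IsUniformlyNonpretentious.isNonpretentious : Prop :=
  ∀ (hg : ∀ n, ‖g n‖ ≤ 1) (h : IsUniformlyNonpretentious g),
    IsNonpretentious g

end API

/-! ## Liouville and Möbius are non-pretentious -/

/-- The Liouville function `λ` does not pretend to be any twisted Dirichlet character:
`inf_{|t| ≤ x} 𝔻(λ, χ(n) n^{it}; x)² → ∞` for every fixed `χ`. This follows from the
Vinogradov–Korobov zero-free region (indeed `M_χ(λ; x) ≥ (1/3 - o(1)) log log x`).
(Matomäki–Radziwiłł–Tao 2015, §1, discussion after Conjecture 1.5, eq. (1.12).) [cite: Tao2015, §1  discussion after Conjecture 1.5  eq] -/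
def isNonpretentious_liouville : Prop :=
  IsNonpretentious (fun n ↦ (ArithmeticFunction.liouville n : ℂ))

/-- The Möbius function `μ` does not pretend to be any twisted Dirichlet character (it agrees
with `λ` on primes, so its pretentious distances coincide with those of `λ`).
(Matomäki–Radziwiłł–Tao 2015, §1.) [cite: Tao2015, §1] -/
def isNonpretentious_moebius : Prop :=
  IsNonpretentious (fun n ↦ (ArithmeticFunction.moebius n : ℂ))

/-! ## Discharges

Elementary consequences of the definitions (Tao 2016, §1: the hypothesis of Theorem 1.3 —
non-pretentiousness uniformly over all characters of period `≤ A` — trivially implies the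
per-character hypothesis of Corollary 1.5, an infimum over a larger family being smaller). -/

section Discharges

variable {g : ℕ → ℂ} {x : ℝ}

/-- The twisted character `n ↦ χ(n) n^{it}` is `1`-bounded. [folklore] -/
theorem norm_twistedChar_le_one {q : ℕ} (χ : DirichletCharacter ℂ q) (t : ℝ) (n : ℕ) :
    ‖twistedChar χ t n‖ ≤ 1 := by
  unfold twistedChar
  rw [norm_mul]
  refine mul_le_one₀ (χ.norm_le_one n) (norm_nonneg _) ?_
  rcases Nat.eq_zero_or_pos n with rfl | hn
  · by_cases ht : ((t : ℝ) : ℂ) * I = 0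
    · simp [ht]
    · simp [Complex.zero_cpow ht]
  · rw [Complex.norm_natCast_cpow_of_pos hn]
    simp

/-- For `x ≥ 0` and `1`-bounded `g`, the infimum `inf_{χ mod q} M_χ(g; x)` over all Dirichlet
characters of a fixed modulus is nonnegative. [folklore] -/
theorem iInf_charNonpretentiousness_nonneg (hg : ∀ n, ‖g n‖ ≤ 1) (q : ℕ) (hx : 0 ≤ x) :
    0 ≤ ⨅ χ : DirichletCharacter ℂ q, charNonpretentiousness g χ x :=
  le_ciInf fun χ ↦ charNonpretentiousness_nonneg hg χ hx

/-- **Discharge** of `nonpretentiousness_le_charNonpretentiousness`: `M(g; x, Q) ≤ M_χ(g; x)` for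
every character `χ` of modulus `1 ≤ q ≤ Q`, `x ≥ 0`, `g` `1`-bounded. Both infima in (1.8) are over
families bounded below by `0`, so `ciInf_le` applies twice.
(Tao 2016, §1, (1.8); hypothesis of Theorem 1.3.) [cite: TaoFMP2016, §1 (1.8) / Theorem 1.3 hypothesis] -/
theorem nonpretentiousness_le_charNonpretentiousness_holds :
    nonpretentiousness_le_charNonpretentiousness (g := g) (x := x) := by
  intro hg hx Q q hq hqQ χ
  have hqfloor : q ≤ ⌊Q⌋₊ := Nat.le_floor hqQ
  have h1 : (⨅ χ' : DirichletCharacter ℂ q, charNonpretentiousness g χ' x) ≤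
      charNonpretentiousness g χ x := by
    refine ciInf_le ⟨0, ?_⟩ χ
    rintro _ ⟨χ', rfl⟩
    exact charNonpretentiousness_nonneg hg χ' hx
  refine le_trans ?_ h1
  unfold nonpretentiousness
  refine ciInf_le (f := fun q' : Set.Icc 1 ⌊Q⌋₊ ↦
      ⨅ χ' : DirichletCharacter ℂ (q' : ℕ), charNonpretentiousness g χ' x) ⟨0, ?_⟩ ⟨q, hq, hqfloor⟩
  rintro _ ⟨q', rfl⟩
  exact iInf_charNonpretentiousness_nonneg hg q' hx

/-- **Discharge** of `IsUniformlyNonpretentious.isNonpretentious`: if `M(g; x, x) → ∞` and `g` is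
`1`-bounded then `M_χ(g; x) → ∞` for every fixed Dirichlet character `χ` mod `q ≥ 1`, because
`M(g; x, x) ≤ M_χ(g; x)` as soon as `x ≥ q`. This is the (trivial) passage from the uniform
hypothesis of Tao 2016, Theorem 1.3 to the per-character hypothesis of Corollary 1.5.
[cite: TaoFMP2016, §1 (1.8): M(g;x,Q) ≤ M_χ(g;x) for q ≤ Q; Theorem 1.3 ⇒ Corollary 1.5 hypothesis] -/
theorem IsUniformlyNonpretentious.isNonpretentious_holds :
    IsUniformlyNonpretentious.isNonpretentious (g := g) := by
  intro hg h q _ χ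
  have hq : 1 ≤ q := NeZero.one_le
  refine tendsto_atTop_mono' atTop ?_ h
  filter_upwards [eventually_ge_atTop (q : ℝ)] with x hx
  have hx0 : (0 : ℝ) ≤ x := le_trans (Nat.cast_nonneg q) hx
  exact nonpretentiousness_le_charNonpretentiousness_holds hg hx0 hq hx χ

end Discharges

/-! ## Discharge of `pretentiousDist_mul_mul_le`

Granville–Soundararajan (2008), §1: for functions `η_j : 𝕌 → ℝ_{≥ 0}` on the closed unit disc
`𝕌` with `η_j(zw) ≤ η_j(z) + η_j(w)`, the "norm" `‖𝐳‖ = (∑_j η_j(z_j)²)^{1/2}` on `𝕌^ℕ`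
satisfies `‖𝐳 × 𝐰‖ ≤ ‖𝐳‖ + ‖𝐰‖` (their display (5)), by expanding the square and Cauchy–Schwarz;
the example `η_j(z)² = a_j (1 - Re z)` with `a_j ≥ 0` qualifies ("this settles the case
`|z| = |w| = 1`, and one can extend this to all pairs `z, w ∈ 𝕌`"), and the choice `a_j = 1/p`
for primes `p ≤ x` (§2) gives `𝔻(1, fg; x) ≤ 𝔻(1, f; x) + 𝔻(1, g; x)`.
Since `Re (f₁ f₂ · conj (g₁ g₂)) = Re ((f₁ conj g₁) · (f₂ conj g₂))` summand-wise, the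
multiplicative form `𝔻(f₁f₂, g₁g₂; x) ≤ 𝔻(f₁, g₁; x) + 𝔻(f₂, g₂; x)` is exactly this inequality
applied to `z_p = f₁(p) conj (g₁ p)` and `w_p = f₂(p) conj (g₂ p)`, both in `𝕌`.
[cite: GranvilleSoundararajan2008, §1 (5) and §2] -/

section MulMulLe

variable {f₁ f₂ g₁ g₂ : ℕ → ℂ}

/-- The pointwise inequality behind the Granville–Soundararajan triangle inequality, on the closed
unit disc: with `η(z)² = 1 - Re z`, one has `η(zw)² ≤ (η(z) + η(w))²` for `|z|, |w| ≤ 1`.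
Proof: `1 - Re (zw) - (1 - Re z) - (1 - Re w) = Im z · Im w - (1 - Re z)(1 - Re w)` and
`Im z · Im w ≤ 2 η(z) η(w)` because `(Im z)² ≤ 1 - (Re z)² ≤ 2 (1 - Re z)`.
(Granville–Soundararajan 2008, §1, the example `η_j(z)² = a_j (1 - Re z)` on `𝕌`.)
[cite: GranvilleSoundararajan2008, §1] -/
private theorem one_sub_re_mul_le {z w : ℂ} (hz : ‖z‖ ≤ 1) (hw : ‖w‖ ≤ 1) :
    1 - (z * w).re ≤
      (1 - z.re) + (1 - w.re) + 2 * (Real.sqrt (1 - z.re) * Real.sqrt (1 - w.re)) := by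
  have hz2 : z.re * z.re + z.im * z.im ≤ 1 := by
    rw [← Complex.normSq_apply, Complex.normSq_eq_norm_sq]
    exact pow_le_one₀ (norm_nonneg z) hz
  have hw2 : w.re * w.re + w.im * w.im ≤ 1 := by
    rw [← Complex.normSq_apply, Complex.normSq_eq_norm_sq]
    exact pow_le_one₀ (norm_nonneg w) hw
  have hzre : z.re ≤ 1 := (abs_le.mp ((Complex.abs_re_le_norm z).trans hz)).2
  have hwre : w.re ≤ 1 := (abs_le.mp ((Complex.abs_re_le_norm w).trans hw)).2
  have hb : z.im ^ 2 ≤ 2 * (1 - z.re) := by nlinarith [sq_nonneg (1 - z.re)]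
  have hd : w.im ^ 2 ≤ 2 * (1 - w.re) := by nlinarith [sq_nonneg (1 - w.re)]
  have h2 : Real.sqrt 2 * Real.sqrt 2 = 2 := Real.mul_self_sqrt zero_le_two
  have key : z.im * w.im ≤ 2 * (Real.sqrt (1 - z.re) * Real.sqrt (1 - w.re)) :=
    calc z.im * w.im ≤ |z.im * w.im| := le_abs_self _
      _ = |z.im| * |w.im| := abs_mul _ _
      _ ≤ Real.sqrt (2 * (1 - z.re)) * Real.sqrt (2 * (1 - w.re)) :=
        mul_le_mul (Real.abs_le_sqrt hb) (Real.abs_le_sqrt hd) (abs_nonneg _)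
          (Real.sqrt_nonneg _)
      _ = 2 * (Real.sqrt (1 - z.re) * Real.sqrt (1 - w.re)) := by
        rw [Real.sqrt_mul zero_le_two, Real.sqrt_mul zero_le_two]
        linear_combination (Real.sqrt (1 - z.re) * Real.sqrt (1 - w.re)) * h2
  rw [Complex.mul_re]
  nlinarith [key, mul_nonneg (sub_nonneg.mpr hzre) (sub_nonneg.mpr hwre)]

/-- The weighted form of `one_sub_re_mul_le`: dividing by a weight `c ≥ 0` (here `c = p`),
`(1 - Re (zw))/c ≤ (√((1 - Re z)/c) + √((1 - Re w)/c))²`, i.e. `η_j(zw) ≤ η_j(z) + η_j(w)` for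
`η_j(z)² = a_j (1 - Re z)`, `a_j = 1/c`. [cite: GranvilleSoundararajan2008, §1] -/
private theorem one_sub_re_mul_div_le {z w : ℂ} (hz : ‖z‖ ≤ 1) (hw : ‖w‖ ≤ 1) {c : ℝ}
    (hc : 0 ≤ c) :
    (1 - (z * w).re) / c ≤ (1 - z.re) / c + (1 - w.re) / c
      + 2 * (Real.sqrt ((1 - z.re) / c) * Real.sqrt ((1 - w.re) / c)) := by
  have hsqrt : Real.sqrt ((1 - z.re) / c) * Real.sqrt ((1 - w.re) / c)
      = Real.sqrt (1 - z.re) * Real.sqrt (1 - w.re) / c := by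
    rw [Real.sqrt_div' _ hc, Real.sqrt_div' _ hc, div_mul_div_comm, Real.mul_self_sqrt hc]
  calc (1 - (z * w).re) / c
      ≤ ((1 - z.re) + (1 - w.re) + 2 * (Real.sqrt (1 - z.re) * Real.sqrt (1 - w.re))) / c :=
        div_le_div_of_nonneg_right (one_sub_re_mul_le hz hw) hc
    _ = (1 - z.re) / c + (1 - w.re) / c
          + 2 * (Real.sqrt ((1 - z.re) / c) * Real.sqrt ((1 - w.re) / c)) := by
        rw [hsqrt]; ring

/-- The Cauchy–Schwarz step of Granville–Soundararajan's triangle inequality (display (5) of §1 in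
the 2008 paper): if `C_i ≤ A_i + B_i + 2 √A_i √B_i = (√A_i + √B_i)²` termwise with
`A_i, B_i ≥ 0`, then `√(∑ C_i) ≤ √(∑ A_i) + √(∑ B_i)`, because
`∑ √A_i √B_i ≤ √(∑ A_i) √(∑ B_i)`. [cite: GranvilleSoundararajan2008, §1 (5)] -/
private theorem sqrt_sum_le_of_termwise {ι : Type*} (s : Finset ι) {A B C : ι → ℝ}
    (hA : ∀ i, 0 ≤ A i) (hB : ∀ i, 0 ≤ B i)
    (h : ∀ i ∈ s, C i ≤ A i + B i + 2 * (Real.sqrt (A i) * Real.sqrt (B i))) :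
    Real.sqrt (∑ i ∈ s, C i) ≤ Real.sqrt (∑ i ∈ s, A i) + Real.sqrt (∑ i ∈ s, B i) := by
  have hsA : 0 ≤ ∑ i ∈ s, A i := Finset.sum_nonneg fun i _ ↦ hA i
  have hsB : 0 ≤ ∑ i ∈ s, B i := Finset.sum_nonneg fun i _ ↦ hB i
  refine Real.sqrt_le_iff.mpr ⟨add_nonneg (Real.sqrt_nonneg _) (Real.sqrt_nonneg _), ?_⟩
  have hCS := Real.sum_sqrt_mul_sqrt_le s hA hB
  calc ∑ i ∈ s, C i ≤ ∑ i ∈ s, (A i + B i + 2 * (Real.sqrt (A i) * Real.sqrt (B i))) :=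
        Finset.sum_le_sum h
    _ = ∑ i ∈ s, A i + ∑ i ∈ s, B i + 2 * ∑ i ∈ s, Real.sqrt (A i) * Real.sqrt (B i) := by
        rw [Finset.sum_add_distrib, Finset.sum_add_distrib, Finset.mul_sum]
    _ ≤ ∑ i ∈ s, A i + ∑ i ∈ s, B i
          + 2 * (Real.sqrt (∑ i ∈ s, A i) * Real.sqrt (∑ i ∈ s, B i)) := by linarith
    _ = (Real.sqrt (∑ i ∈ s, A i) + Real.sqrt (∑ i ∈ s, B i)) ^ 2 := by
        rw [add_sq, Real.sq_sqrt hsA, Real.sq_sqrt hsB]; ring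

/-- For `1`-bounded values, `‖a · conj b‖ ≤ 1`. [folklore] -/
private theorem norm_mul_conj_le_one {a b : ℂ} (ha : ‖a‖ ≤ 1) (hb : ‖b‖ ≤ 1) :
    ‖a * conj b‖ ≤ 1 := by
  rw [norm_mul, Complex.norm_conj]
  exact mul_le_one₀ ha (norm_nonneg _) hb

/-- **Discharge** of `pretentiousDist_mul_mul_le` (the multiplicative form of the
Granville–Soundararajan triangle inequality): for `1`-bounded `f₁ f₂ g₁ g₂ : ℕ → ℂ`,
`𝔻(f₁ f₂, g₁ g₂; x) ≤ 𝔻(f₁, g₁; x) + 𝔻(f₂, g₂; x)`.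
Proof as printed in Granville–Soundararajan 2008, §1–§2: termwise
`η_p(z_p w_p) ≤ η_p(z_p) + η_p(w_p)` for `η_p(z)² = (1 - Re z)/p` on the closed unit disc
(`one_sub_re_mul_div_le`, with `z_p = f₁(p) conj g₁(p)`, `w_p = f₂(p) conj g₂(p)`), then
Cauchy–Schwarz (`sqrt_sum_le_of_termwise`, their (5)).
[cite: GranvilleSoundararajan2008, §1 (5) and §2 (triangle inequality for 𝔻)] -/
theorem pretentiousDist_mul_mul_le_holds :
    pretentiousDist_mul_mul_le (f₁ := f₁) (f₂ := f₂) (g₁ := g₁) (g₂ := g₂) := by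
  intro hf₁ hf₂ hg₁ hg₂ x
  unfold pretentiousDist pretentiousDistSq
  refine sqrt_sum_le_of_termwise (Nat.primesLE ⌊x⌋₊)
    (A := fun p ↦ (1 - (f₁ p * conj (g₁ p)).re) / (p : ℝ))
    (B := fun p ↦ (1 - (f₂ p * conj (g₂ p)).re) / (p : ℝ))
    (C := fun p ↦ (1 - ((f₁ * f₂) p * conj ((g₁ * g₂) p)).re) / (p : ℝ))
    (fun p ↦ ?_) (fun p ↦ ?_) (fun p _ ↦ ?_)
  · exact div_nonneg (sub_nonneg.mpr ((Complex.re_le_norm _).trans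
      (norm_mul_conj_le_one (hf₁ p) (hg₁ p)))) (Nat.cast_nonneg p)
  · exact div_nonneg (sub_nonneg.mpr ((Complex.re_le_norm _).trans
      (norm_mul_conj_le_one (hf₂ p) (hg₂ p)))) (Nat.cast_nonneg p)
  · have hzw : (f₁ * f₂) p * conj ((g₁ * g₂) p)
        = (f₁ p * conj (g₁ p)) * (f₂ p * conj (g₂ p)) := by
      simp only [Pi.mul_apply, map_mul]; ring
    rw [hzw]
    exact one_sub_re_mul_div_le (norm_mul_conj_le_one (hf₁ p) (hg₁ p))
      (norm_mul_conj_le_one (hf₂ p) (hg₂ p)) (Nat.cast_nonneg p)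

end MulMulLe

end

end Literature.NumberTheory.Sieve
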